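import Summits.Ventures.QEC.Thresholds.ToricCodePhenomenologicalThresholds
import Literature.InformationTheory.QuantumCodes.CSSPhenomenologicalThreshold
import HarnessLib

/-!
# Certified phenomenological thresholds (`q = p`) for every CSS LDPC family: `p₀(w+1)`

Venture QEC, `Summits/Ventures/QEC/Thresholds/` (LADDER-QEC rung Q5, phenomenological noise beyond the
toric code; qec-lit-2 gen 3). Packaging of the Literature theorem
`CSSPhenom.cssPhenomThreshold_of_rowWeight` (`CSSPhenomenologicalThreshold.lean`: the `T`-round
noisy-measurement memory experiment of an ARBITRARY CSS code, one error type, minimum-weight space-time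
decoding, `4(w+1)² p(1-p) < 1`) in the cell's vocabulary `IsThresholdLowerBound` / `thresholdValue`.
HONEST FRAMING: UNCONDITIONAL, kernel axioms, no named fact, no `native_decide`; a FAMILY hypothesis is
required — space-time size subexponential in the distance, `(n_i + m_i)·T_i·r^{d_i} → 0` for all
`0 < r < 1` (e.g. `d_i → ∞` at least logarithmically faster than `log((n_i + m_i) T_i)`) — and is NOT
established here for any explicit bivariate-bicycle family; the numbers are thresholds of WHATEVER family
with the stated check weight satisfies it.

| check weight `w` | `p₀(w+1)` | class |
|---|---|---|
| `4` | `p₀(5) = (5-2√6)/10 ≈ .0101` | surface / toric (agrees with `ToricCodePhenomenologicalElementary.lean`) |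
| `6` | `p₀(7) = (7-4√3)/14 ≈ .0051` (`thresholdValue_seven`, `.0051 < · < .0052`) | bivariate-bicycle / gross-code check weight |

## References

* [DumerKovalevPryadko2015] I. Dumer, A. A. Kovalev, L. P. Pryadko, PRL 115 (2015) 050502, Thm. 3 and p. 5
  ("w → w + 2").
* [DennisEtAl2002] E. Dennis, A. Kitaev, A. Landahl, J. Preskill, J. Math. Phys. 43 (2002) 4452, §5.3.
-/

noncomputable section

namespace Summit.Ventures.QEC.Thresholds

open Filter Topology Finset Matrix
open Literature.InformationTheory.QuantumCodes
open Literature.InformationTheory.QuantumCodes.CSSPhenom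

variable {n m : ℕ → ℕ}

/-- The family of failure probabilities of the `T_i`-round memory experiments of a CSS family under
phenomenological noise with `q = p`. [cite: DennisEtAl2002, §5.2 (Prob_fail), §5.3 (p = q)] -/
def cssPhenomFailureFamily (H : ∀ i, Matrix (Fin (m i)) (Fin (n i)) (ZMod 2))
    (SX : ∀ i, Submodule (ZMod 2) (Fin (n i) → ZMod 2)) (T : ℕ → ℕ)
    (D : ∀ i, CSSPhenom.STDecoder (Fin (m i)) (Fin (n i)) (T i)) : ℕ → ℝ → ℝ :=
  fun i p => CSSPhenom.phenomFailureProb (H i) (T i) (SX i : Set (Fin (n i) → ZMod 2)) (D i) p p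

/-- **Phenomenological threshold `p₀(w+1)` for every CSS LDPC family** (`q = p`): checks of weight `≤ w`,
`1 ≤ d_i ≤` distance, `(n_i + m_i) T_i r^{d_i} → 0` for all `0 < r < 1`, ANY minimum-weight space-time
decoders; then `p₀(w+1)` is a lower bound on the accuracy threshold. UNCONDITIONAL.
[cite: DumerKovalevPryadko2015, Thm 3 with p. 5 (w → w + 2)] -/
theorem cssPhenom_isThresholdLowerBound_of_rowWeight (H : ∀ i, Matrix (Fin (m i)) (Fin (n i)) (ZMod 2))
    (SX : ∀ i, Submodule (ZMod 2) (Fin (n i) → ZMod 2)) (T : ℕ → ℕ)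
    (D : ∀ i, CSSPhenom.STDecoder (Fin (m i)) (Fin (n i)) (T i))
    (hD : ∀ i, (D i).IsMinWeight (stSyn (H i) (T i)) (stCycles (H i) (T i)) hammingNorm)
    {w : ℕ} (hrow : ∀ i j, (rowSupp (H i) j).card ≤ w) (d : ℕ → ℕ) (hd1 : ∀ i, 1 ≤ d i)
    (hd : ∀ i (x : Fin (n i) → ZMod 2), H i *ᵥ x = 0 → x ∉ SX i → d i ≤ hammingNorm x)
    (hgrowth : ∀ r : ℝ, 0 < r → r < 1 →
      Tendsto (fun i => (((n i + m i) * T i : ℕ) : ℝ) * r ^ d i) atTop (𝓝 0)) :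
    IsThresholdLowerBound (cssPhenomFailureFamily H SX T D) (thresholdValue ((w + 1 : ℕ) : ℝ)) := by
  intro p hp₀ hpp
  set K : ℝ := ((w + 1 : ℕ) : ℝ) with hK
  have hK1 : 1 ≤ K := by
    rw [hK]
    exact_mod_cast (show 1 ≤ w + 1 by omega)
  have hp : p ≤ 1 / 2 := le_trans hpp.le (thresholdValue_le_half K)
  have h4 : 4 * K ^ 2 * (p * (1 - p)) < 1 := by
    have hsum : p + thresholdValue K < 1 := by
      have := thresholdValue_le_half K
      linarith
    have hlt := mul_one_sub_lt_mul_one_sub hpp hsum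
    have hK2 : 0 < 4 * K ^ 2 := by positivity
    calc 4 * K ^ 2 * (p * (1 - p)) < 4 * K ^ 2 * (thresholdValue K * (1 - thresholdValue K)) :=
          mul_lt_mul_of_pos_left hlt hK2
      _ = 1 := four_mul_sq_mul_thresholdValue hK1
  exact cssPhenomThreshold_of_rowWeight H SX T D hD hrow d hd1 hd hgrowth hp₀ hp h4

/-- **Weight-4 instance** (surface / toric class): phenomenological threshold `≥ p₀(5) ≈ .0101` for
every weight-4 CSS family as above. [cite: DumerKovalevPryadko2015, p. 5 (w → w + 2)] -/
theorem cssPhenom_isThresholdLowerBound_weightFour (H : ∀ i, Matrix (Fin (m i)) (Fin (n i)) (ZMod 2))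
    (SX : ∀ i, Submodule (ZMod 2) (Fin (n i) → ZMod 2)) (T : ℕ → ℕ)
    (D : ∀ i, CSSPhenom.STDecoder (Fin (m i)) (Fin (n i)) (T i))
    (hD : ∀ i, (D i).IsMinWeight (stSyn (H i) (T i)) (stCycles (H i) (T i)) hammingNorm)
    (hrow : ∀ i j, (rowSupp (H i) j).card ≤ 4) (d : ℕ → ℕ) (hd1 : ∀ i, 1 ≤ d i)
    (hd : ∀ i (x : Fin (n i) → ZMod 2), H i *ᵥ x = 0 → x ∉ SX i → d i ≤ hammingNorm x)
    (hgrowth : ∀ r : ℝ, 0 < r → r < 1 →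
      Tendsto (fun i => (((n i + m i) * T i : ℕ) : ℝ) * r ^ d i) atTop (𝓝 0)) :
    IsThresholdLowerBound (cssPhenomFailureFamily H SX T D) (thresholdValue 5) := by
  have h := cssPhenom_isThresholdLowerBound_of_rowWeight H SX T D hD (w := 4) hrow d hd1 hd hgrowth
  norm_num at h
  exact h

/-- **Weight-6 instance** (bivariate-bicycle / gross-code check weight): phenomenological threshold
`≥ p₀(7) ≈ .0051` for every weight-6 CSS family as above. [cite: DumerKovalevPryadko2015, p. 5 (w → w + 2)] -/
theorem cssPhenom_isThresholdLowerBound_weightSix (H : ∀ i, Matrix (Fin (m i)) (Fin (n i)) (ZMod 2))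
    (SX : ∀ i, Submodule (ZMod 2) (Fin (n i) → ZMod 2)) (T : ℕ → ℕ)
    (D : ∀ i, CSSPhenom.STDecoder (Fin (m i)) (Fin (n i)) (T i))
    (hD : ∀ i, (D i).IsMinWeight (stSyn (H i) (T i)) (stCycles (H i) (T i)) hammingNorm)
    (hrow : ∀ i j, (rowSupp (H i) j).card ≤ 6) (d : ℕ → ℕ) (hd1 : ∀ i, 1 ≤ d i)
    (hd : ∀ i (x : Fin (n i) → ZMod 2), H i *ᵥ x = 0 → x ∉ SX i → d i ≤ hammingNorm x)
    (hgrowth : ∀ r : ℝ, 0 < r → r < 1 →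
      Tendsto (fun i => (((n i + m i) * T i : ℕ) : ℝ) * r ^ d i) atTop (𝓝 0)) :
    IsThresholdLowerBound (cssPhenomFailureFamily H SX T D) (thresholdValue 7) := by
  have h := cssPhenom_isThresholdLowerBound_of_rowWeight H SX T D hD (w := 6) hrow d hd1 hd hgrowth
  norm_num at h
  exact h

/-- `p₀(7) = (7 - 4√3)/14`. [cite: DennisEtAl2002, §5.3 eq. (threshold_iso) (with ν = 7)] -/
theorem thresholdValue_seven : thresholdValue 7 = (7 - 4 * Real.sqrt 3) / 14 := by
  unfold thresholdValue
  have h : (1 - 1 / (7 : ℝ) ^ 2) = (4 * Real.sqrt 3 / 7) ^ 2 := by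
    rw [div_pow, mul_pow, Real.sq_sqrt (by norm_num : (0 : ℝ) ≤ 3)]
    norm_num
  rw [h, Real.sqrt_sq (by positivity)]
  ring

/-- Decimal enclosure `.0051 < p₀(7) < .0052`. [cite: DennisEtAl2002, §5.3 eq. (threshold_iso) (with ν = 7)] -/
theorem thresholdValue_seven_bounds : (0.0051 : ℝ) < thresholdValue 7 ∧ thresholdValue 7 < 0.0052 := by
  unfold thresholdValue
  have hx : (1 - 1 / (7 : ℝ) ^ 2) = 48 / 49 := by norm_num
  rw [hx]
  constructor
  · have : Real.sqrt (48 / 49) < 0.9898 := by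
      rw [Real.sqrt_lt' (by norm_num)]
      norm_num
    linarith
  · have : (0.9896 : ℝ) < Real.sqrt (48 / 49) := by
      rw [Real.lt_sqrt (by norm_num)]
      norm_num
    linarith

end Summit.Ventures.QEC.Thresholds
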